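import Mathlib
import Summits.Langlands.Langlands.Theses.DyadicOddResidue

/-!
# Close `ℤ_p`-points of a ring share a minimal prime (Thorne 2026, Thm 2.12, abstract form)
# — first lemma of crux idea `close-approximation-cc`, crux `DyadicEisensteinFM`, stmt-Langlands-18741

Helper file for the crux `Summit.Langlands.Langlands.Theses.DyadicOddResidue.DyadicEisensteinFM`.
Crux idea `close-approximation-cc` (`Cruxes/DyadicEisensteinFM/Ideas/close-approximation-cc.md`, P1
"port first") hinges on the commutative-algebra statement behind J. Thorne, arXiv:2608.07186 (2026),
Thm 2.12: *`ℤ_p`-points of a complete Noetherian local ring that are `p`-adically close enough lie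
on a common irreducible component* — it is what turns a `ϖ^C`-close modular approximation `ρ′` of
`ρ` into a point of the irreducible component of `Spec R^{ps}` through `ρ`.  The card typed it as

`CloseShareComponent : ∀ p R [complete Noetherian local] (f : R →+* ℤ_[p]), ∃ N, ∀ g : R →+* ℤ_[p],
  (∀ x, p ^ N ∣ f x - g x) → ∃ P ∈ minimalPrimes R, P ≤ ker f ∧ P ≤ ker g`.

We prove it here, in fact for ANY commutative ring with finitely many minimal primes (so for every
Noetherian ring; completeness and locality are not needed for this formulation):

* `exists_minimalPrime_le_ker_of_close` — finitely many minimal primes suffice;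
* `closeShareComponent` — the Noetherian case, in the card's signature (minus the unused
  `IsLocalRing` / `IsAdicComplete` binders, which only weaken it).

## Proof

Let `P₁, …, P_r` be the minimal primes and, for each `P_i ⊄ ker f`, pick `x_i ∈ P_i` with
`f(x_i) ≠ 0`; take `N > max_i v_p(f(x_i))`.  If `g ≡ f (mod p^N)` pointwise, the prime `ker g`
(`ℤ_p` is a domain) contains some minimal prime `P_j`; were `P_j ⊄ ker f`, then `g(x_j) = 0` would
give `p^N ∣ f(x_j) ≠ 0`, i.e. `v_p(f(x_j)) ≥ N` — absurd.  So `P_j ≤ ker f ∩ ker g`.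

(Thorne's Thm 2.12 is stated for complete Noetherian local `ℤ_p`-algebras with a uniform `N(R, f)`;
the uniformity in `g` is exactly what is proved.)
-/

set_option linter.dupNamespace false -- project-wide option (lakefile weak.linter.dupNamespace); `Summit.Langlands.Langlands` is the mandated namespace

namespace Summit.Langlands.Langlands.Theorems.DyadicEisensteinFM

/-- **Close `ℤ_p`-valued points share a minimal prime** (abstract form of Thorne 2026, Thm 2.12):
if the commutative ring `R` has finitely many minimal primes and `f : R → ℤ_p` is a ring map, there
is `N` such that every ring map `g : R → ℤ_p` with `p^N ∣ f(x) - g(x)` for all `x` has a minimal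
prime of `R` inside `ker f ∩ ker g` (i.e. `f` and `g` lie on a common irreducible component of
`Spec R`).  See the module docstring for the proof. -/
theorem exists_minimalPrime_le_ker_of_close {R : Type*} [CommRing R]
    (hfin : (minimalPrimes R).Finite) (p : ℕ) [Fact p.Prime] (f : R →+* ℤ_[p]) :
    ∃ N : ℕ, ∀ g : R →+* ℤ_[p], (∀ x : R, (p : ℤ_[p]) ^ N ∣ f x - g x) →
      ∃ P ∈ minimalPrimes R, P ≤ RingHom.ker f ∧ P ≤ RingHom.ker g := by
  classical
  -- a witness `w P ∈ P` with `f (w P) ≠ 0` for each prime `P ⊄ ker f`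
  have hw : ∀ P : Ideal R, ¬ P ≤ RingHom.ker f → ∃ x ∈ P, f x ≠ 0 := by
    intro P hP
    by_contra! h
    exact hP fun x hx => (RingHom.mem_ker).mpr (h x hx)
  choose! w hwP hwf using hw
  let S : Finset (Ideal R) := hfin.toFinset.filter fun P => ¬ P ≤ RingHom.ker f
  refine ⟨S.sup (fun P => (f (w P)).valuation) + 1, fun g hg => ?_⟩
  haveI : (RingHom.ker g).IsPrime := RingHom.ker_isPrime g
  obtain ⟨P₀, hP₀, hP₀g⟩ :=
    Ideal.exists_minimalPrimes_le (show (⊥ : Ideal R) ≤ RingHom.ker g from bot_le)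
  refine ⟨P₀, hP₀, ?_, hP₀g⟩
  by_contra hP₀f
  have hx : w P₀ ∈ P₀ := hwP P₀ hP₀f
  have hfx : f (w P₀) ≠ 0 := hwf P₀ hP₀f
  have hgx : g (w P₀) = 0 := (RingHom.mem_ker).mp (hP₀g hx)
  have hdvd := hg (w P₀)
  rw [hgx, sub_zero] at hdvd
  have hle : S.sup (fun P => (f (w P)).valuation) + 1 ≤ (f (w P₀)).valuation :=
    (PadicInt.mem_span_pow_iff_le_valuation _ hfx _).mp (Ideal.mem_span_singleton.mpr hdvd)
  have hPS : P₀ ∈ S := by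
    simp only [S, Finset.mem_filter, Set.Finite.mem_toFinset]
    exact ⟨hP₀, hP₀f⟩
  have := Finset.le_sup (f := fun P => (f (w P)).valuation) hPS
  omega

/-- **`CloseShareComponent`** (crux idea `close-approximation-cc`, first lemma; Thorne 2026 Thm 2.12
in abstract form) for a Noetherian ring `R` and `f : R → ℤ_p`: there is `N` such that every
`g : R → ℤ_p` with `p^N ∣ f x - g x` for all `x` shares a minimal prime with `f`
(`P ≤ ker f ⊓ ker g` for some minimal prime `P` of `R`).  The card's extra hypotheses (local,
`𝔪`-adically complete) are not needed. -/
theorem closeShareComponent (p : ℕ) [Fact p.Prime] (R : Type*) [CommRing R] [IsNoetherianRing R]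
    (f : R →+* ℤ_[p]) :
    ∃ N : ℕ, ∀ g : R →+* ℤ_[p], (∀ x : R, (p : ℤ_[p]) ^ N ∣ f x - g x) →
      ∃ P : Ideal R, P ∈ minimalPrimes R ∧ P ≤ RingHom.ker f ∧ P ≤ RingHom.ker g := by
  obtain ⟨N, hN⟩ := exists_minimalPrime_le_ker_of_close
    (minimalPrimes.finite_of_isNoetherianRing R) p f
  exact ⟨N, fun g hg => let ⟨P, hP, h⟩ := hN g hg; ⟨P, hP, h⟩⟩

end Summit.Langlands.Langlands.Theorems.DyadicEisensteinFM
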